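import Summits.QuantumAdvantage.QuantumAdvantage.Theses.ArithStatLadder
import Summits.QuantumAdvantage.QuantumAdvantage.Theorems.AcZeroRung.Negative.LoadBearing -- buildfix 2026-08-19: `AcZeroRung` (dropped from the route at rev 3) lives on verbatim as the `@[conjecture] def` of this landed file
import Literature.NumberTheory.QuadraticFields.ThreeTorsion
import Literature.Computability.Complexity.CircuitClasses
import Literature.Computability.Complexity.ConstantDepth
import Literature.Computability.Complexity.TM2PassThrough
import Literature.Computability.Complexity.StackWords

/-!
# Sketch (crux-ideate, round 1, ideator 3) for crux `IqThreeNotPPoly` (stmt-QuantumAdvantage-2422)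

First lemmas of the two idea cards
* `sign-test-correlation-apex` (the sign test `(t − 2)·(2·𝟙_IQ3 − 1) = |t − 2| ≥ 1`: every
  correlation rung gives a Boolean worst-case lower bound for `IQ3` with no arithmetic input;
  the crux is the Boolean shadow of the ladder's limit `PPolyRung`);
* `mirror-promise-split` (Scholz reflection + Kummer unit criterion as a LOSSLESS worst-case
  promise reduction: the crux follows from promise-hardness of either of the two real-quadratic
  predicates `U` (unit of `ℚ(√3d)` is 3-primary) / `R` (`3 ∣ h(ℚ(√3d))`)).
Everything is stated over existing declarations. The line of card A, `iqThreeNotPPoly_of_ppolyRung : PPolyRung → IqThreeNotPPoly`,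
is PROVED here (kernel-checked, incl. the `encodeNat`/`Nat.testBit` bridge), and so is the Boolean
shadow of the filed AC⁰ rung, `iq3_not_mem_AC0_of_acZeroRung : AcZeroRung → IQ3 ∉ AC⁰`. No `sorry`. Nothing here is a route item.
-/

noncomputable section

open scoped Classical BigOperators
open Filter

namespace Summit.QuantumAdvantage.QuantumAdvantage.Cruxes.IqThreeNotPPoly.Ideator3

open Literature.Computability.Complexity Literature.NumberTheory.QuadraticFields
  Summit.QuantumAdvantage.QuantumAdvantage.Theses.ArithStatLadder
open Literature.Probability.RandomGraphs.LowDegree (sgn sgn_true sgn_false)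

/-! ### The crux, unpacked -/

/-- `-d` is a fundamental discriminant (the route's literal spelling). -/
def IsNegFund (d : ℕ) : Prop :=
  ((-(d:ℤ)) % 4 = 1 ∧ Squarefree (-(d:ℤ)) ∧ (-(d:ℤ)) ≠ 1) ∨
    (4 ∣ (-(d:ℤ)) ∧ ((-(d:ℤ)) / 4 % 4 = 2 ∨ (-(d:ℤ)) / 4 % 4 = 3) ∧ Squarefree ((-(d:ℤ)) / 4))

/-- `𝒟_n`: the `n`-bit `d` with `-d` fundamental — the route's window VERBATIM (same text as in
`AcZeroRung`, so that the route's rungs specialise to it by `rfl`; the predicate is `IsNegFund d`). -/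
def fundWindow (n : ℕ) : Finset ℕ :=
  ((Finset.Ico (2 ^ (n - 1)) (2 ^ n)).filter (fun d : ℕ => (((-(d:ℤ)) % 4 = 1 ∧ Squarefree (-(d:ℤ)) ∧ (-(d:ℤ)) ≠ 1) ∨ (4 ∣ (-(d:ℤ)) ∧ ((-(d:ℤ)) / 4 % 4 = 2 ∨ (-(d:ℤ)) / 4 % 4 = 3) ∧ Squarefree ((-(d:ℤ)) / 4)))))

/-- `IQ3 ⊆ ℕ`. -/
def iq3Set : Set ℕ := {d : ℕ | IsNegFund d ∧ 3 ∣ BinaryQuadraticForm.classNumber (-(d:ℤ))}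

/-- `IQ3 ⊆ {0,1}*` (LSB-first binary). -/
def iq3Lang : Language Bool := Computability.encodingNatBool.toLanguage iq3Set

/-- The crux is literally `iq3Lang ∉ P/poly`. -/
theorem iqThreeNotPPoly_iff : IqThreeNotPPoly ↔ iq3Lang ∉ PPoly := Iff.rfl

/-- `IsNegFund 0` is false, so a fundamental `-d` has `d ≥ 1`. -/
theorem pos_of_isNegFund {d : ℕ} (hd : IsNegFund d) : 0 < d := by
  rcases Nat.eq_zero_or_pos d with rfl | h
  · exfalso
    rcases hd with ⟨h1, -, -⟩ | ⟨-, h2, -⟩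
    · norm_num at h1
    · norm_num at h2
  · exact h

/-! ### Card `sign-test-correlation-apex` -/

/-- The IQ3 sign `s*(d) = 2·𝟙[3 ∣ h(−d)] − 1`. -/
def signIQ3 (d : ℕ) : ℝ := if 3 ∣ BinaryQuadraticForm.classNumber (-(d:ℤ)) then 1 else -1

/-- **The sign test (pointwise, proved).** For `-d` fundamental, with `t = #Cl₃(−d) ∈ {1,3,9,…}`
and `3 ∣ h ↔ t ≥ 3`: `(t − 2)·s*(d) = |t − 2| ≥ 1`. The centring constant `2` of
Davenport–Heilbronn lies strictly between the two smallest values `1 < 2 < 3` of `t`; that is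
the whole mechanism. -/
theorem sign_test {d : ℕ} (hd : IsNegFund d) :
    1 ≤ ((quadFieldThreeTorsion (-(d:ℤ)) : ℝ) - 2) * signIQ3 d := by
  have hD0 : (-(d:ℤ)) < 0 := by
    have := pos_of_isNegFund hd
    omega
  obtain ⟨r, hr⟩ := exists_quadFieldThreeTorsion_eq_pow (-(d:ℤ))
  have hiff := three_dvd_classNumber_iff_one_lt_quadFieldThreeTorsion hd hD0
  by_cases h3 : 3 ∣ BinaryQuadraticForm.classNumber (-(d:ℤ))
  · have h1 : 1 < quadFieldThreeTorsion (-(d:ℤ)) := hiff.1 h3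
    have h3le : 3 ≤ quadFieldThreeTorsion (-(d:ℤ)) := by
      rw [hr] at h1 ⊢
      have hr0 : r ≠ 0 := by
        rintro rfl
        simp at h1
      calc 3 = 3 ^ 1 := by norm_num
        _ ≤ 3 ^ r := Nat.pow_le_pow_right (by norm_num) (Nat.one_le_iff_ne_zero.2 hr0)
    simp only [signIQ3, if_pos h3, mul_one]
    have : (3:ℝ) ≤ quadFieldThreeTorsion (-(d:ℤ)) := by exact_mod_cast h3le
    linarith
  · have h1 : ¬ 1 < quadFieldThreeTorsion (-(d:ℤ)) := fun h => h3 (hiff.2 h)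
    have hpos := quadFieldThreeTorsion_pos (-(d:ℤ))
    have heq : quadFieldThreeTorsion (-(d:ℤ)) = 1 := by omega
    simp only [signIQ3, if_neg h3, heq]
    norm_num

/-- **Sum form (proved): the IQ3 sign has correlation `≥ #𝒟_n` with `t − 2` on every window.**
So NO correlation bound `≤ ε·#𝒟_n` with `ε < 1` can hold for a device computing `𝟙_IQ3` on
`𝒟_n` — whatever the device class. No density / second-moment input is used (contrast: the
average-case face `AvgFaceBeyondPrior` needs `dens(3 ∣ h) > 1/3`, OPEN). -/
theorem sum_sign_test (n : ℕ) :
    ((fundWindow n).card : ℝ) ≤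
      ∑ d ∈ fundWindow n, ((quadFieldThreeTorsion (-(d:ℤ)) : ℝ) - 2) * signIQ3 d := by
  have h : ∑ _d ∈ fundWindow n, (1:ℝ) ≤
      ∑ d ∈ fundWindow n, ((quadFieldThreeTorsion (-(d:ℤ)) : ℝ) - 2) * signIQ3 d :=
    Finset.sum_le_sum fun d hd => sign_test (Finset.mem_filter.1 hd).2
  simpa using h


/-- Windows are nonempty for `n ≥ 6`: `d = 8p` with a Bertrand prime `2^(n-4) < p < 2^(n-3)`
(`−8p = 4·(−2p)`, `−2p ≡ 2 (mod 4)`, `2p` squarefree) — the argument of the sibling crux file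
`Cruxes/AvgFaceBeyondPrior/Disproof.lean: fundBlock_nonempty`. -/
theorem fundWindow_nonempty_of_six_le {n : ℕ} (hn : 6 ≤ n) : (fundWindow n).Nonempty := by
  obtain ⟨p, hp, hlt, hle⟩ := Nat.exists_prime_lt_and_le_two_mul (2 ^ (n - 4)) (by positivity)
  have hodd : p % 2 = 1 := by
    rcases hp.eq_two_or_odd' with rfl | hodd
    · have : 4 ≤ 2 ^ (n - 4) := by
        calc (4:ℕ) = 2 ^ 2 := by norm_num
          _ ≤ 2 ^ (n - 4) := Nat.pow_le_pow_right Nat.two_pos (by omega)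
      omega
    · exact Nat.odd_iff.1 hodd
  have hplt : p < 2 ^ (n - 3) := by
    have h2 : 2 * 2 ^ (n - 4) = 2 ^ (n - 3) := by
      rw [← pow_succ']; congr 1; omega
    rcases Nat.lt_or_eq_of_le hle with h | h
    · omega
    · exfalso
      have : 2 ∣ p := by rw [h]; exact dvd_mul_right 2 _
      omega
  have hlo : 2 ^ (n - 1) = 8 * 2 ^ (n - 4) := by
    rw [show n - 1 = 3 + (n - 4) by omega, pow_add]; norm_num
  have hhi : 2 ^ n = 8 * 2 ^ (n - 3) := by
    rw [show n = 3 + (n - 3) by omega, pow_add]; norm_num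
  refine ⟨8 * p, Finset.mem_filter.2 ⟨?_, Or.inr ⟨⟨-(2 * (p:ℤ)), by push_cast; ring⟩, ?_, ?_⟩⟩⟩
  · rw [Finset.mem_Ico]; omega
  · left; omega
  · rw [show (-((8 * p : ℕ) : ℤ)) / 4 = -((2 * p : ℕ) : ℤ) by omega, ← Int.squarefree_natAbs,
      Int.natAbs_neg, Int.natAbs_natCast, Nat.squarefree_mul]
    · exact ⟨Nat.prime_two.squarefree, hp.squarefree⟩
    · exact (Nat.coprime_primes Nat.prime_two hp).2 (by omega)

/-- Codewords of window elements have length exactly `n`. -/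
theorem length_encodeNat_of_mem_window {n d : ℕ} (hd : d ∈ fundWindow n) (hn : 1 ≤ n) :
    (Computability.encodeNat d).length = n := by
  have hI := (Finset.mem_filter.1 hd).1
  rw [Finset.mem_Ico] at hI
  rw [TM2Pass.length_encodeNat_eq_size]
  apply le_antisymm
  · exact Nat.size_le.2 hI.2
  · have : n - 1 < Nat.size d := Nat.lt_size.2 hI.1
    omega

/-- The bits of a codeword are the binary digits. -/
theorem getD_encodeNat (d i : ℕ) : (Computability.encodeNat d).getD i false = d.testBit i := by
  rw [← testBit_bitsToNat_eq_getD, bitsToNat_encodeNat]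

/-- Transport of a family's evaluation along `x.length = n`. -/
theorem eval_family_eq (C : CircuitFamily) {x : List Bool} {n : ℕ} (h : x.length = n) :
    (C x.length).eval x.get = (C n).eval (fun i : Fin n => x.getD i false) := by
  subst h
  congr 1
  funext i
  simp only [List.get_eq_getElem, List.getD_eq_getElem?_getD, List.getElem?_eq_getElem i.2,
    Option.getD_some]

/-- **The apex `PPolyRung` (hypothesis-type; the ladder's limit):** `AcZeroRung` with the depth
bound removed and the basis `B₂` — "the centred 3-torsion `t − 2` has vanishing correlation, along
`n`-bit fundamental discriminants, with every polynomial-size Boolean circuit" (computational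
Davenport–Heilbronn). Separation-strength (it implies the crux, hence `NP ⊄ P/poly`). -/
def PPolyRung : Prop :=
  ∀ t : ℤ → ℕ, (∀ (D : ℤ) (K : Type) [Field K] [NumberField K], Module.finrank ℚ K = 2 →
      NumberField.discr K = D →
        t D = Nat.card {c : ClassGroup (NumberField.RingOfIntegers K) // c ^ 3 = 1}) →
    ∀ p : Polynomial ℕ, ∀ ε : ℝ, 0 < ε → ∀ᶠ n : ℕ in atTop, ∀ C : Circuit (Fin n),
      C.IsOver B2 → C.size ≤ p.eval n →
        |∑ d ∈ fundWindow n, ((t (-(d:ℤ)) : ℝ) - 2) *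
            sgn (C.eval fun i : Fin n => Nat.testBit d i)|
          ≤ ε * ((fundWindow n).card : ℝ)

/-- **First lemma of the card = the line** (glue; provable now): `PPolyRung → IqThreeNotPPoly`.
Proof: a `P/poly` family for `IQ3` gives, at each length `n ≥ 2`, a `B₂`-circuit `Cₙ` of size
`≤ p(n)` with `sgn (Cₙ (bits d)) = −signIQ3 d` on `𝒟_n` (tree convention `sgn true = −1`) (codewords `encodeNat d`, `2^{n-1} ≤ d < 2ⁿ`,
have length `n` and `get i = testBit d i`); `sum_sign_test` with `t := quadFieldThreeTorsion`
(`quadFieldThreeTorsion_spec`) contradicts the rung at `ε = 1/2` (windows nonempty for `n ≥ 2`). -/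
theorem iqThreeNotPPoly_of_ppolyRung (h : PPolyRung) : IqThreeNotPPoly := by
  intro hPP
  obtain ⟨p, hp⟩ := Set.mem_iUnion.1 hPP
  obtain ⟨C, hC, hDec⟩ := hp
  have hDec' : ∀ x : List Bool, (C x.length).eval x.get = iq3Lang.boolIndicator x := hDec
  have hev := h quadFieldThreeTorsion quadFieldThreeTorsion_spec p (1 / 2) (by norm_num)
  obtain ⟨n, hn6, hn⟩ := ((eventually_ge_atTop 6).and hev).exists
  have hbound := hn (C n) (hC n).1 (hC n).2
  have hsum : ∑ d ∈ fundWindow n, ((quadFieldThreeTorsion (-(d:ℤ)) : ℝ) - 2) *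
        sgn ((C n).eval fun i : Fin n => Nat.testBit d i)
      = -∑ d ∈ fundWindow n, ((quadFieldThreeTorsion (-(d:ℤ)) : ℝ) - 2) * signIQ3 d := by
    rw [← Finset.sum_neg_distrib]
    refine Finset.sum_congr rfl fun d hd => ?_
    have hfund : IsNegFund d := (Finset.mem_filter.1 hd).2
    have hlen : (Computability.encodeNat d).length = n :=
      length_encodeNat_of_mem_window hd (by omega)
    have key : ((C n).eval fun i : Fin n => Nat.testBit d i) =
        iq3Lang.boolIndicator (Computability.encodeNat d) := by
      rw [← hDec' (Computability.encodeNat d), eval_family_eq C hlen]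
      congr 1
      funext i
      exact (getD_encodeNat d i).symm
    have hmem : iq3Lang.boolIndicator (Computability.encodeNat d) = true ↔
        3 ∣ BinaryQuadraticForm.classNumber (-(d:ℤ)) := by
      rw [← Set.mem_iff_boolIndicator]
      exact (Computability.Encoding.mem_toLanguage_iff Computability.encodingNatBool iq3Set d).trans
        ⟨fun h => h.2, fun h => ⟨hfund, h⟩⟩
    rw [key]
    by_cases h3 : 3 ∣ BinaryQuadraticForm.classNumber (-(d:ℤ))
    · have hb : iq3Lang.boolIndicator (Computability.encodeNat d) = true := hmem.2 h3
      simp only [hb, sgn_true, signIQ3, if_pos h3]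
      ring
    · have hb : iq3Lang.boolIndicator (Computability.encodeNat d) = false := by
        simpa using (mt hmem.1 h3)
      simp only [hb, sgn_false, signIQ3, if_neg h3]
      ring
  rw [hsum, abs_neg] at hbound
  have hcard := sum_sign_test n
  have hne : (0:ℝ) < (fundWindow n).card := by
    exact_mod_cast Finset.card_pos.2 (fundWindow_nonempty_of_six_le hn6)
  have habs := le_abs_self (∑ d ∈ fundWindow n, ((quadFieldThreeTorsion (-(d:ℤ)) : ℝ) - 2) * signIQ3 d)
  linarith

/-- **Boolean shadow of the filed AC⁰ rung** (same proof, PROVED; a support item the tenure planner can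
file NOW, cf. MobiusLadder's `LiouvilleNotAC0`): `AcZeroRung → IQ3 ∉ AC⁰`, no arithmetic input. -/
theorem iq3_not_mem_AC0_of_acZeroRung (h : Theorems.AcZeroRung.Negative.AcZeroRung) : iq3Lang ∉ AC0 := by
  intro hAC
  obtain ⟨k, p, C, hC, hDec⟩ := hAC
  have hDec' : ∀ x : List Bool, (C x.length).eval x.get = iq3Lang.boolIndicator x := hDec
  have hev := h quadFieldThreeTorsion quadFieldThreeTorsion_spec k p (1 / 2) (by norm_num)
  obtain ⟨n, hn6, hn⟩ := ((eventually_ge_atTop 6).and hev).exists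
  have hbound : |∑ d ∈ fundWindow n, ((quadFieldThreeTorsion (-(d:ℤ)) : ℝ) - 2) *
        sgn ((C n).eval fun i : Fin n => Nat.testBit d i)| ≤ 1 / 2 * ((fundWindow n).card : ℝ) :=
    hn (C n) (hC n).1 (hC n).2.1 (hC n).2.2
  have hsum : ∑ d ∈ fundWindow n, ((quadFieldThreeTorsion (-(d:ℤ)) : ℝ) - 2) *
        sgn ((C n).eval fun i : Fin n => Nat.testBit d i)
      = -∑ d ∈ fundWindow n, ((quadFieldThreeTorsion (-(d:ℤ)) : ℝ) - 2) * signIQ3 d := by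
    rw [← Finset.sum_neg_distrib]
    refine Finset.sum_congr rfl fun d hd => ?_
    have hfund : IsNegFund d := (Finset.mem_filter.1 hd).2
    have hlen : (Computability.encodeNat d).length = n :=
      length_encodeNat_of_mem_window hd (by omega)
    have key : ((C n).eval fun i : Fin n => Nat.testBit d i) =
        iq3Lang.boolIndicator (Computability.encodeNat d) := by
      rw [← hDec' (Computability.encodeNat d), eval_family_eq C hlen]
      congr 1
      funext i
      exact (getD_encodeNat d i).symm
    have hmem : iq3Lang.boolIndicator (Computability.encodeNat d) = true ↔
        3 ∣ BinaryQuadraticForm.classNumber (-(d:ℤ)) := by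
      rw [← Set.mem_iff_boolIndicator]
      exact (Computability.Encoding.mem_toLanguage_iff Computability.encodingNatBool iq3Set d).trans
        ⟨fun h => h.2, fun h => ⟨hfund, h⟩⟩
    rw [key]
    by_cases h3 : 3 ∣ BinaryQuadraticForm.classNumber (-(d:ℤ))
    · have hb : iq3Lang.boolIndicator (Computability.encodeNat d) = true := hmem.2 h3
      simp only [hb, sgn_true, signIQ3, if_pos h3]
      ring
    · have hb : iq3Lang.boolIndicator (Computability.encodeNat d) = false := by
        simpa using (mt hmem.1 h3)
      simp only [hb, sgn_false, signIQ3, if_neg h3]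
      ring
  rw [hsum, abs_neg] at hbound
  have hcard := sum_sign_test n
  have hne : (0:ℝ) < (fundWindow n).card := by
    exact_mod_cast Finset.card_pos.2 (fundWindow_nonempty_of_six_le hn6)
  have habs := le_abs_self (∑ d ∈ fundWindow n, ((quadFieldThreeTorsion (-(d:ℤ)) : ℝ) - 2) * signIQ3 d)
  linarith

/-! ### Card `mirror-promise-split` -/

/-- **Promise hardness for circuits**: no polynomial-size `B₂`-circuit family computes the
predicate `Q` correctly on every codeword `encodeNat d` with `-d` fundamental and `P d`
(no requirement off the promise). -/
def PromiseHard (P Q : ℕ → Prop) : Prop :=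
  ¬ ∃ (C : CircuitFamily) (p : Polynomial ℕ), (∀ n, (C n).IsOver B2 ∧ (C n).size ≤ p.eval n) ∧
      ∀ d : ℕ, IsNegFund d → P d →
        ((C (Computability.encodeNat d).length).eval (Computability.encodeNat d).get = true ↔ Q d)

/-- **The mirror identity as a hypothesis** (Scholz 1932 reflection `r₃(3d) ≤ r₃(−d) ≤ r₃(3d)+1`
+ Kummer/Hecke: the defect is `1` iff the fundamental unit of `ℚ(√3d)` is 3-primary):
pointwise on fundamental `-d`, `3 ∣ h(−d) ↔ U d ∨ R d` with `U d` = "ε(ℚ(√3d)) is 3-primary"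
(sibling sketch `Cruxes/AvgFaceBeyondPrior/SketchIdeator2.lean: UnitIsThreePrimary`) and
`R d` = "`3 ∣ h(ℚ(√3d))`" (`quadFieldThreeTorsion (mirrorDisc d) ≠ 1`). To be vendored as a
named CFT fact; here abstract in `U R`. -/
def MirrorIdentity (U R : ℕ → Prop) : Prop :=
  ∀ d : ℕ, IsNegFund d → (3 ∣ BinaryQuadraticForm.classNumber (-(d:ℤ)) ↔ (U d ∨ R d))

/-- Unpacking `IQ3 ∈ P/poly` on codewords (proved). -/
theorem circuit_of_mem_PPoly (hPP : iq3Lang ∈ PPoly) :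
    ∃ (C : CircuitFamily) (p : Polynomial ℕ), (∀ n, (C n).IsOver B2 ∧ (C n).size ≤ p.eval n) ∧
      ∀ d : ℕ, ((C (Computability.encodeNat d).length).eval (Computability.encodeNat d).get = true ↔
        (IsNegFund d ∧ 3 ∣ BinaryQuadraticForm.classNumber (-(d:ℤ)))) := by
  obtain ⟨p, hp⟩ := Set.mem_iUnion.1 hPP
  obtain ⟨C, hC, hDec⟩ := hp
  refine ⟨C, p, hC, fun d => ?_⟩
  rw [hDec (Computability.encodeNat d), ← Set.mem_iff_boolIndicator]
  exact Computability.Encoding.mem_toLanguage_iff Computability.encodingNatBool iq3Set d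

/-- **First lemma of the card (proved): the crux follows from promise-hardness of the UNIT
predicate on the promise `¬R` (3-rank of `ℚ(√3d)` is zero)** — lossless, worst case. -/
theorem iqThreeNotPPoly_of_promiseHard_unit {U R : ℕ → Prop} (hM : MirrorIdentity U R)
    (hU : PromiseHard (fun d => ¬ R d) U) : IqThreeNotPPoly := by
  intro hPP
  obtain ⟨C, p, hC, hdec⟩ := circuit_of_mem_PPoly hPP
  exact hU ⟨C, p, hC, fun d hd hR => by rw [hdec d, hM d hd]; tauto⟩

/-- **… and symmetrically from promise-hardness of the REAL 3-divisibility predicate `R` on the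
promise `¬U` (unit not 3-primary)** (proved). Either real-quadratic apex suffices. -/
theorem iqThreeNotPPoly_of_promiseHard_real {U R : ℕ → Prop} (hM : MirrorIdentity U R)
    (hR : PromiseHard (fun d => ¬ U d) R) : IqThreeNotPPoly := by
  intro hPP
  obtain ⟨C, p, hC, hdec⟩ := circuit_of_mem_PPoly hPP
  exact hR ⟨C, p, hC, fun d hd hU => by rw [hdec d, hM d hd]; tauto⟩

/-- **Refutation surface for the disprover (proved): if BOTH total predicates are `P/poly`-easy in
the circuit sense below, the crux is false.** (`TotalEasy Q` = some poly-size family computes `Q`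
on all fundamental codewords; with the identity, OR the two families and AND with a fundamentality
circuit — the last needs `{d : IsNegFund d} ∈ P/poly`, i.e. squarefreeness, itself open
classically: so the honest surface is relative to a fundamentality oracle, recorded as hypothesis
`hF`.) -/
def TotalEasy (Q : ℕ → Prop) : Prop :=
  ∃ (C : CircuitFamily) (p : Polynomial ℕ), (∀ n, (C n).IsOver B2 ∧ (C n).size ≤ p.eval n) ∧
    ∀ d : ℕ, IsNegFund d →
      ((C (Computability.encodeNat d).length).eval (Computability.encodeNat d).get = true ↔ Q d)

/-- Closure step used by the surface: from circuits for `U`, `R` on fundamental codewords and a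
`P/poly` decision of fundamentality-on-codewords, a `P/poly` family for `IQ3` (OR/AND of three
families + rejection of non-codewords). Routine circuit plumbing; stated, not proved here. -/
def OrAndClosure (U R : ℕ → Prop) : Prop :=
  TotalEasy U → TotalEasy R →
    Computability.encodingNatBool.toLanguage {d : ℕ | IsNegFund d} ∈ PPoly →
      MirrorIdentity U R → iq3Lang ∈ PPoly

theorem not_iqThreeNotPPoly_of_easy {U R : ℕ → Prop} (hcl : OrAndClosure U R) (hM : MirrorIdentity U R)
    (hU : TotalEasy U) (hR : TotalEasy R)
    (hF : Computability.encodingNatBool.toLanguage {d : ℕ | IsNegFund d} ∈ PPoly) :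
    ¬ IqThreeNotPPoly := fun h => h (hcl hU hR hF hM)

end Summit.QuantumAdvantage.QuantumAdvantage.Cruxes.IqThreeNotPPoly.Ideator3
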